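import Summits.Ventures.WeilGRH.DualTrigKernelFamily
import Summits.Ventures.WeilGRH.DualTrigFamilyValues
import Summits.Ventures.WeilGRH.DualTrigCertMod7OddLog3Half
import Summits.Ventures.WeilGRH.DualTrigCertMod5OddChi2ILog3Half
import Summits.Ventures.WeilGRH.DualTrigCertMod5OddChi2NegILog3Half
import Summits.Ventures.WeilGRH.DualTrigCertMod4OddLog3Half
import Summits.Ventures.WeilGRH.DualTrigCertMod20OddLog3
import HarnessLib

/-!
# Format D-K: family forms (every modulus `q ≥ q₀`) of the landed per-modulus rungs (part 1/2)

Cell `rh-explicit`, WEIL TRACK — GRH ARM, route B (weil-grh-3).  Each landed format-D-K instance file proves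
`cert_…_check : c.check = true` by `decide +kernel` and a rung for the characters of ONE modulus `c.q`.  By
`DKCert.weilPositivityOnChar_family_of_check` (`DualTrigKernelFamily.lean`) the SAME certificate proves the rung for
every modulus `q ≥ c.q` and every character with the listed parity and window values (and `χ(p) = 0` at the window
primes dividing `c.q`): the key-group family statements of the arm's A2 table, at zero additional kernel cost.

| theorem | q ≥ | parity | t | window values |
|---|---|---|---|---|
| `weilPositivityOnChar_family_ge7_odd_chi2_one_log3half` | 7 | 1 | log 3 / 2 | χ(2) = 1 |
| `weilPositivityOnChar_family_ge5_odd_chi2_I_log3half` | 5 | 1 | log 3 / 2 | χ(2) = i |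
| `weilPositivityOnChar_family_ge5_odd_chi2_negI_log3half` | 5 | 1 | log 3 / 2 | χ(2) = −i |
| `weilPositivityOnChar_family_ge4_odd_log3half` | 4 | 1 | log 3 / 2 | χ(2) = 0 |
| `weilPositivityOnChar_family_ge20_odd_chi3_chi7_one_log3` | 20 | 1 | log 3 | χ(2) = 0, χ(3) = 1, χ(5) = 0, χ(7) = 1 |

No named facts, no `sorry`, no kernel evaluation in this file; axioms standard.
-/

namespace Summit.Ventures.WeilGRH

open Literature.NumberTheory.LFunctions Literature.Analysis.ValidatedNumerics.NumericsMP

/-- **Family form of `weilPositivityOnChar_mod7_odd_chi2_one_log3half`**: the same kernel certificate `cert_q7_odd_log3half` proves the rung `t = log 3 / 2` for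
EVERY modulus `q ≥ 7` and every Dirichlet character `χ` mod `q` with parity 1 and χ(2) = 1
(`DKCert.weilPositivityOnChar_family_of_check`: the modulus enters the weight only through `+ log q`). [folklore] -/
theorem weilPositivityOnChar_family_ge7_odd_chi2_one_log3half {q : ℕ} (hq : 7 ≤ q) (χ : DirichletCharacter ℂ q) (hpar : charParity χ = 1) (hχ2 : χ 2 = 1) :
    WeilPositivityOnChar χ (Real.log 3 / 2) := by
  have h := DKCert.weilPositivityOnChar_family_of_check cert_q7_odd_log3half_check hq (by omega) χ hpar ?_ ?_
  · have e : Real.log ((cert_q7_odd_log3half.N : ℝ) + 1) / 2 = Real.log 3 / 2 := by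
      rw [show cert_q7_odd_log3half.N = 2 from rfl]; norm_num
    rw [e] at h
    exact h
  · intro val hval
    simp only [cert_q7_odd_log3half, List.mem_singleton] at hval
    subst hval
    change χ ((2 : ℕ) : ZMod q) = _
    rw [Nat.cast_ofNat, hχ2]
    rw [DKCert.one_eq_expPhase]
    rw [DKCert.valZ_eq_expPhase, Complex.exp_eq_exp_iff_exists_int]
    exact ⟨0, by push_cast; ring⟩
  · exact DKCert.hχ0_of_coprime_window χ (by
      intro n h2 hn
      rw [show cert_q7_odd_log3half.N = 2 from rfl] at hn
      rw [show cert_q7_odd_log3half.q = 7 from rfl]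
      interval_cases n
      all_goals decide)

/-- **Family form of `weilPositivityOnChar_mod5_odd_chi2_I_log3half`**: the same kernel certificate `cert_q5_odd_i_log3half` proves the rung `t = log 3 / 2` for
EVERY modulus `q ≥ 5` and every Dirichlet character `χ` mod `q` with parity 1 and χ(2) = i
(`DKCert.weilPositivityOnChar_family_of_check`: the modulus enters the weight only through `+ log q`). [folklore] -/
theorem weilPositivityOnChar_family_ge5_odd_chi2_I_log3half {q : ℕ} (hq : 5 ≤ q) (χ : DirichletCharacter ℂ q) (hpar : charParity χ = 1) (hχ2 : χ 2 = Complex.I) :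
    WeilPositivityOnChar χ (Real.log 3 / 2) := by
  have h := DKCert.weilPositivityOnChar_family_of_check cert_q5_odd_i_log3half_check hq (by omega) χ hpar ?_ ?_
  · have e : Real.log ((cert_q5_odd_i_log3half.N : ℝ) + 1) / 2 = Real.log 3 / 2 := by
      rw [show cert_q5_odd_i_log3half.N = 2 from rfl]; norm_num
    rw [e] at h
    exact h
  · intro val hval
    simp only [cert_q5_odd_i_log3half, List.mem_singleton] at hval
    subst hval
    change χ ((2 : ℕ) : ZMod q) = _
    rw [Nat.cast_ofNat, hχ2]
    rw [DKCert.I_eq_expPhase]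
    rw [DKCert.valZ_eq_expPhase, Complex.exp_eq_exp_iff_exists_int]
    exact ⟨0, by push_cast; ring⟩
  · exact DKCert.hχ0_of_coprime_window χ (by
      intro n h2 hn
      rw [show cert_q5_odd_i_log3half.N = 2 from rfl] at hn
      rw [show cert_q5_odd_i_log3half.q = 5 from rfl]
      interval_cases n
      all_goals decide)

/-- **Family form of `weilPositivityOnChar_mod5_odd_chi2_negI_log3half`**: the same kernel certificate `cert_q5_odd_negi_log3half` proves the rung `t = log 3 / 2` for
EVERY modulus `q ≥ 5` and every Dirichlet character `χ` mod `q` with parity 1 and χ(2) = −i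
(`DKCert.weilPositivityOnChar_family_of_check`: the modulus enters the weight only through `+ log q`). [folklore] -/
theorem weilPositivityOnChar_family_ge5_odd_chi2_negI_log3half {q : ℕ} (hq : 5 ≤ q) (χ : DirichletCharacter ℂ q) (hpar : charParity χ = 1) (hχ2 : χ 2 = -Complex.I) :
    WeilPositivityOnChar χ (Real.log 3 / 2) := by
  have h := DKCert.weilPositivityOnChar_family_of_check cert_q5_odd_negi_log3half_check hq (by omega) χ hpar ?_ ?_
  · have e : Real.log ((cert_q5_odd_negi_log3half.N : ℝ) + 1) / 2 = Real.log 3 / 2 := by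
      rw [show cert_q5_odd_negi_log3half.N = 2 from rfl]; norm_num
    rw [e] at h
    exact h
  · intro val hval
    simp only [cert_q5_odd_negi_log3half, List.mem_singleton] at hval
    subst hval
    change χ ((2 : ℕ) : ZMod q) = _
    rw [Nat.cast_ofNat, hχ2]
    rw [DKCert.neg_I_eq_expPhase]
    rw [DKCert.valZ_eq_expPhase, Complex.exp_eq_exp_iff_exists_int]
    exact ⟨0, by push_cast; ring⟩
  · exact DKCert.hχ0_of_coprime_window χ (by
      intro n h2 hn
      rw [show cert_q5_odd_negi_log3half.N = 2 from rfl] at hn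
      rw [show cert_q5_odd_negi_log3half.q = 5 from rfl]
      interval_cases n
      all_goals decide)

/-- **Family form of `weilPositivityOnChar_mod4_odd_log3half`**: the same kernel certificate `cert_q4_odd_log3half` proves the rung `t = log 3 / 2` for
EVERY modulus `q ≥ 4` and every Dirichlet character `χ` mod `q` with parity 1 and χ(2) = 0
(`DKCert.weilPositivityOnChar_family_of_check`: the modulus enters the weight only through `+ log q`). [folklore] -/
theorem weilPositivityOnChar_family_ge4_odd_log3half {q : ℕ} (hq : 4 ≤ q) (χ : DirichletCharacter ℂ q) (hpar : charParity χ = 1) (hχ2 : χ 2 = 0) :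
    WeilPositivityOnChar χ (Real.log 3 / 2) := by
  have h := DKCert.weilPositivityOnChar_family_of_check cert_q4_odd_log3half_check hq (by omega) χ hpar ?_ ?_
  · have e : Real.log ((cert_q4_odd_log3half.N : ℝ) + 1) / 2 = Real.log 3 / 2 := by
      rw [show cert_q4_odd_log3half.N = 2 from rfl]; norm_num
    rw [e] at h
    exact h
  · intro val hval
    simp [cert_q4_odd_log3half] at hval
  · intro n hn hpp hco
    rw [show cert_q4_odd_log3half.N = 2 from rfl] at hn
    rw [show cert_q4_odd_log3half.q = 4 from rfl] at hco
    interval_cases n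
    · exact absurd hpp not_isPrimePow_zero
    · exact absurd hpp not_isPrimePow_one
    · rw [Nat.cast_ofNat, hχ2]

/-- **Family form of `weilPositivityOnChar_mod20_odd_chi3_chi7_one_log3`**: the same kernel certificate `cert_q20_odd_log3` proves the rung `t = log 3` for
EVERY modulus `q ≥ 20` and every Dirichlet character `χ` mod `q` with parity 1 and χ(2) = 0, χ(3) = 1, χ(5) = 0, χ(7) = 1
(`DKCert.weilPositivityOnChar_family_of_check`: the modulus enters the weight only through `+ log q`). [folklore] -/
theorem weilPositivityOnChar_family_ge20_odd_chi3_chi7_one_log3 {q : ℕ} (hq : 20 ≤ q) (χ : DirichletCharacter ℂ q) (hpar : charParity χ = 1) (hχ2 : χ 2 = 0) (hχ3 : χ 3 = 1) (hχ5 : χ 5 = 0) (hχ7 : χ 7 = 1) :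
    WeilPositivityOnChar χ (Real.log 3) := by
  have h := DKCert.weilPositivityOnChar_family_of_check cert_q20_odd_log3_check hq (by omega) χ hpar ?_ ?_
  · have e : Real.log ((cert_q20_odd_log3.N : ℝ) + 1) / 2 = Real.log 3 := by
      rw [show cert_q20_odd_log3.N = 8 from rfl]
      have h9 : ((8 : ℕ) : ℝ) + 1 = 3 ^ 2 := by norm_num
      rw [h9, Real.log_pow]; ring
    rw [e] at h
    exact h
  · intro val hval
    simp only [cert_q20_odd_log3, List.mem_cons, List.mem_nil_iff, or_false] at hval
    rcases hval with rfl | rfl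
    · change χ ((3 : ℕ) : ZMod q) = _
      rw [Nat.cast_ofNat, hχ3]
      rw [DKCert.one_eq_expPhase]
      rw [DKCert.valZ_eq_expPhase, Complex.exp_eq_exp_iff_exists_int]
      exact ⟨0, by push_cast; ring⟩
    · change χ ((7 : ℕ) : ZMod q) = _
      rw [Nat.cast_ofNat, hχ7]
      rw [DKCert.one_eq_expPhase]
      rw [DKCert.valZ_eq_expPhase, Complex.exp_eq_exp_iff_exists_int]
      exact ⟨0, by push_cast; ring⟩
  · intro n hn hpp hco
    rw [show cert_q20_odd_log3.N = 8 from rfl] at hn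
    rw [show cert_q20_odd_log3.q = 20 from rfl] at hco
    interval_cases n
    · exact absurd hpp not_isPrimePow_zero
    · exact absurd hpp not_isPrimePow_one
    · rw [Nat.cast_ofNat, hχ2]
    · exact absurd (by decide : Nat.Coprime 3 20) hco
    · rw [show ((4 : ℕ) : ZMod q) = (2 : ZMod q) ^ 2 by norm_num, map_pow, hχ2]; simp
    · rw [Nat.cast_ofNat, hχ5]
    · exact absurd hpp (by decide)
    · exact absurd (by decide : Nat.Coprime 7 20) hco
    · rw [show ((8 : ℕ) : ZMod q) = (2 : ZMod q) ^ 3 by norm_num, map_pow, hχ2]; simp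

end Summit.Ventures.WeilGRH
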